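import Summits.QuantumFields.YangMills.Theorems.SoftKernelBoostCovariance.Negative.TieLoadBearing
import Summits.QuantumFields.YangMills.Theorems.MirrorModularBoostsPlanarSpectralCone
import Summits.QuantumFields.YangMills.Theorems.PencilRigidityNPointIsotropyOfSibling
import Summits.QuantumFields.YangMills.Theorems.PencilRigidityShellRigidity
import Summits.QuantumFields.YangMills.Theorems.PencilRigidityKernelTransfer
import Summits.QuantumFields.YangMills.Theses.CertificationLength
import HarnessLib

/-!
# `SoftKernelBoostCovariance` implies the sibling route's `NPointIsotropyBelowThreshold` — stub
`stub_belowThresholdOfSoftKernel`, and the structural certificates `14999 ↔ 16180 ← 11686 ← 9663`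

Line `Sketch` of crux `MirrorModularBoosts.SoftKernelBoostCovariance` (stmt-QuantumFields-14999;
route-QuantumFields-MirrorModularBoosts), skeleton v3.7, registered stub `stub_belowThresholdOfSoftKernel` (model-blind,
pure logic over landed theorems; registered signature verbatim).

The four route items
* (B)  `MirrorModularBoosts.CurvatureBoostCovariance`        (stmt-QuantumFields-9663),
* (N)  `PencilRigidity.NPointIsotropy`                        (stmt-QuantumFields-11686),
* (B′) `MirrorModularBoosts.SoftKernelBoostCovariance`        (stmt-QuantumFields-14999, this crux),
* (N′) `CertificationLength.NPointIsotropyBelowThreshold`     (stmt-QuantumFields-16180)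

carry the SAME curvature package `W₁` (lattice tie; E0, E0′, E2, E3, E4; translations and proper signed permutations on
`⁰𝒮`; continuum and uniform lattice gap), the SAME reflection positivity in pull-back form for the eight planar frames, and
the SAME conclusion (invariance of every `𝔖ₙ` on `⁰𝒮` under the determinant-one isometries fixing `e₂, e₃`).  They differ
only in the extra hypotheses: (B) the planar spectral cone; (N) a radial continuous two-point kernel; (B′) the cone AND the
soft two-point kernel triple `|K x| ≤ C (1 + ‖x‖^(η-10))`; (N′) the soft kernel triple alone.  Over the landed unbundling
predicates `W1`, `EightFrameRP`, `PlanarCone`, `PlanarInvariant` (`CurvatureBoostCovariance.Negative.Unbundled`),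
`SoftKernel` (`SoftKernelBoostCovariance.Negative.TieLoadBearing`) and `RadialKernel` (`NPointIsotropy.Negative.TieLoadBearing`):

* `nPointIsotropyBelowThreshold_iff` (definitional, `Iff.rfl`): (N′) is
  `∀ G …, W1 r sch S₁ → EightFrameRP S₁ → SoftKernel S₁ → PlanarInvariant S₁`.
* `planarCone_of_osPackage` : the cone is a THEOREM under `W1` and the eight frames — the closed item stmt-QuantumFields-9664,
  `PositivityDiscToOperatorCone.PlanarSpectralCone_of`, fed with E0′, E3 and translations from `W₁`.
* `radialKernel_of_softKernel` : under `W1` (E3, proper signed permutations) and the eight frames the soft kernel IS radial —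
  the landed `KernelTransfer.kernelTransfer_proof` (stmt-QuantumFields-11688: `W(B₄)`-invariance, axis and diagonal
  reflection positivity of `K`) followed by the landed `ShellRigidity_proof` (stmt-QuantumFields-11685).
* **`stub_belowThresholdOfSoftKernel` : (B′) → (N′)** (the registered stub: supply the cone by `planarCone_of_osPackage`);
  `softKernelBoostCovariance_of_belowThreshold` : (N′) → (B′) (forget the cone);
  `softKernelBoostCovariance_iff_belowThreshold` : (B′) ↔ (N′).
* `softKernelBoostCovariance_of_curvatureBoostCovariance` : (B) → (B′) (forget the soft kernel).
* `softKernelBoostCovariance_of_nPointIsotropy` : (N) → (B′) and `belowThreshold_of_nPointIsotropy` : (N) → (N′)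
  (make the soft kernel radial by `radialKernel_of_softKernel`, forget the cone);
  `belowThreshold_of_curvatureBoostCovariance` : (B) → (N′).
* `cruxWeb_of_kernelBound` : modulo `CurvatureKernelBound` (stmt-QuantumFields-11687) the four items are EQUIVALENT —
  (B) → (N) is the landed `nPointIsotropy_of_curvatureBoostCovariance`, and `CurvatureKernelBound ∧ (B′) → (B)` is the
  landed glue `kernelBoundEngineGlue_proof` (stmt-QuantumFields-15000).

So every proof (or refutation) of one of 14999 / 16180 is one of the other, and every proof of 9663 or 11686 closes both.

References: K. Osterwalder, R. Schrader, Comm. Math. Phys. 31 (1973), 42 (1975) (the axioms E0–E4, `⁰𝒮`);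
J. Glimm, A. Jaffe, Quantum Physics (1987) §6.1, §19 (reflection positivity in several frames). [folklore]
-/

noncomputable section

namespace Summit.QuantumFields.YangMills.Theorems.SoftKernelBoostCovariance.Sketch

open scoped BigOperators SchwartzMap
open MeasureTheory Filter Topology
open Literature.MathematicalPhysics.QuantumLattice Literature.MathematicalPhysics.AQFT
  Literature.MathematicalPhysics.QuantumFieldTheory
open Summit.QuantumFields.YangMills.Theorems.NPointIsotropy.Negative (E4 RadialKernel nPointIsotropy_iff)
open Summit.QuantumFields.YangMills.Theorems.CurvatureBoostCovariance.Negative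
  (OSPackage Translations Hypercubic EightFrameRP PlanarCone PlanarInvariant Tie Gaps W1 crux_iff)
open Summit.QuantumFields.YangMills.Theorems.SoftKernelBoostCovariance.Negative
  (SoftKernel softKernelBoostCovariance_iff)

/-! ## §0 The sibling route's crux unbundled; the two model-blind transfers -/

/-- **(N′) unbundled** (definitional): `CertificationLength.NPointIsotropyBelowThreshold` (stmt-QuantumFields-16180) is,
for every compact simple `G` (Borel σ-algebra), `W1 r sch S₁ → EightFrameRP S₁ → SoftKernel S₁ → PlanarInvariant S₁` —
the unbundled form of `SoftKernelBoostCovariance` (`softKernelBoostCovariance_iff`) with the `PlanarCone S₁` slot removed.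
[folklore] -/
theorem nPointIsotropyBelowThreshold_iff :
    Summit.QuantumFields.YangMills.Theses.CertificationLength.NPointIsotropyBelowThreshold ↔
      ∀ (G : Type) [Group G] [TopologicalSpace G] [IsTopologicalGroup G] [CompactSpace G],
        IsCompactSimpleLieGroup G →
        letI : MeasurableSpace G := borel G
        haveI : BorelSpace G := ⟨rfl⟩
        ∀ (r : LatticeRep G) (sch : SpeciesScheme (YMSpecies G)) (S₁ : SchwingerFamily E4),
          W1 r sch S₁ → EightFrameRP S₁ → SoftKernel S₁ → PlanarInvariant S₁ :=
  Iff.rfl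

/-- **The planar spectral cone is free under the OS package, translations and the eight frames**: E0′ (`hOS.2.2.1`) and
E3 (`hOS.2.2.2.2.1`) from the OS package of `W₁`, translations on `⁰𝒮`, plus the eight-frame reflection positivity, are
exactly the hypotheses of the closed item `PlanarSpectralCone` (stmt-QuantumFields-9664, `PlanarSpectralCone_of`); with
`hW : W1 r sch S₁` use `planarCone_of_osPackage hW.2.1 hW.2.2.1 h8`. [folklore] -/
theorem planarCone_of_osPackage {S₁ : SchwingerFamily E4} (hOS : OSPackage S₁) (htr : Translations S₁)
    (h8 : EightFrameRP S₁) : PlanarCone S₁ :=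
  Summit.QuantumFields.YangMills.Cruxes.PlanarSpectralCone.PositivityDiscToOperatorCone.PlanarSpectralCone_of
    S₁ hOS.2.2.1 hOS.2.2.2.2.1 htr h8

/-- **A soft kernel is radial under E3, the proper signed permutations and the eight frames.**  From the soft triple
`⟨K, C, η, hη, hKc, hKb, hKrep⟩` the landed `kernelTransfer_proof` (stmt-QuantumFields-11688) makes `K` `W(B₄)`-invariant and
reflection positive across `x₀ = 0` and `x₀ = x₁` (pointwise), and the landed `ShellRigidity_proof` (stmt-QuantumFields-11685)
then makes a kernel below the pencil threshold `|x|⁻¹⁰` invariant under every linear isometry off `0`; the representation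
clause is kept (verbatim the construction of `levelGrowthLow_of_kernel` in the line skeleton).  With `hW : W1 r sch S₁` use
`radialKernel_of_softKernel hW.2.1.2.2.2.2.1 hW.2.2.2.1 h8 hK`. [folklore] -/
theorem radialKernel_of_softKernel {S₁ : SchwingerFamily E4} (hsym : S₁.toLabelled.IsSymmetric)
    (hhyp : Hypercubic S₁) (h8 : EightFrameRP S₁) (hK : SoftKernel S₁) : RadialKernel S₁ := by
  obtain ⟨Kf, C, η, hη, hKc, hKb, hKrep⟩ := hK
  obtain ⟨hWB4, hax, hdiag⟩ :=
    Summit.QuantumFields.YangMills.Theorems.KernelTransfer.kernelTransfer_proof S₁ Kf hKc hKrep hsym hhyp h8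
  exact ⟨Kf, hKc, fun R x hx =>
    Summit.QuantumFields.YangMills.Cruxes.ShellRigidity.TransverseSmearingPlanarThreshold.ShellRigidity_proof
      Kf hKc ⟨C, η, hη, hKb⟩ hWB4 hax hdiag R x hx, hKrep⟩

/-! ## §1 The registered stub: (B′) → (N′), and its converse -/

/-- **Stub `stub_belowThresholdOfSoftKernel` — BELOW-THRESHOLD TRANSFER (registered signature verbatim; model-blind,
pure logic over the closed item stmt-QuantumFields-9664).**  `SoftKernelBoostCovariance` (stmt-QuantumFields-14999)
implies `CertificationLength.NPointIsotropyBelowThreshold` (stmt-QuantumFields-16180): unbundle both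
(`softKernelBoostCovariance_iff`, `nPointIsotropyBelowThreshold_iff`), and for given `G, r, sch, S₁` with `W1 r sch S₁`,
the eight frames and the soft kernel supply the one missing hypothesis of (B′), the planar spectral cone, by
`planarCone_of_osPackage` (`PlanarSpectralCone_of` from E0′, E3, translations inside `W₁` and the eight frames). [folklore] -/
theorem stub_belowThresholdOfSoftKernel :
    Summit.QuantumFields.YangMills.Theses.MirrorModularBoosts.SoftKernelBoostCovariance →
      Summit.QuantumFields.YangMills.Theses.CertificationLength.NPointIsotropyBelowThreshold := by
  intro hSoft
  rw [nPointIsotropyBelowThreshold_iff]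
  rw [softKernelBoostCovariance_iff] at hSoft
  intro G _ _ _ _ hG r sch S₁ hW h8 hK
  exact hSoft G hG r sch S₁ hW h8 (planarCone_of_osPackage hW.2.1 hW.2.2.1 h8) hK

/-- **(N′) → (B′)** (the trivial direction: forget the planar cone). [folklore] -/
theorem softKernelBoostCovariance_of_belowThreshold :
    Summit.QuantumFields.YangMills.Theses.CertificationLength.NPointIsotropyBelowThreshold →
      Summit.QuantumFields.YangMills.Theses.MirrorModularBoosts.SoftKernelBoostCovariance := by
  intro hN
  rw [softKernelBoostCovariance_iff]
  rw [nPointIsotropyBelowThreshold_iff] at hN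
  intro G _ _ _ _ hG r sch S₁ hW h8 _ hK
  exact hN G hG r sch S₁ hW h8 hK

/-- **(B′) ↔ (N′)**: `MirrorModularBoosts.SoftKernelBoostCovariance` (stmt-QuantumFields-14999) and
`CertificationLength.NPointIsotropyBelowThreshold` (stmt-QuantumFields-16180) are EQUIVALENT statements — one problem filed on
two routes; a proof or a refutation of either is one of the other. [folklore] -/
theorem softKernelBoostCovariance_iff_belowThreshold :
    Summit.QuantumFields.YangMills.Theses.MirrorModularBoosts.SoftKernelBoostCovariance ↔
      Summit.QuantumFields.YangMills.Theses.CertificationLength.NPointIsotropyBelowThreshold :=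
  ⟨stub_belowThresholdOfSoftKernel, softKernelBoostCovariance_of_belowThreshold⟩

/-! ## §2 (B) → (B′) and (N) → (B′), (N) → (N′) -/

/-- **(B) → (B′)**: the parent engine `CurvatureBoostCovariance` (stmt-QuantumFields-9663) implies this crux — one
hypothesis (the soft kernel) more, same conclusion (cf. `softKernelBoostCovariance_of_parent` in the crux's Disproof file).
[folklore] -/
theorem softKernelBoostCovariance_of_curvatureBoostCovariance :
    Summit.QuantumFields.YangMills.Theses.MirrorModularBoosts.CurvatureBoostCovariance →
      Summit.QuantumFields.YangMills.Theses.MirrorModularBoosts.SoftKernelBoostCovariance := by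
  intro h
  rw [softKernelBoostCovariance_iff]
  rw [crux_iff] at h
  intro G _ _ _ _ hG r sch S₁ hW h8 hC _
  exact h G hG r sch S₁ hW h8 hC

/-- **(N) → (B′)**: `PencilRigidity.NPointIsotropy` (stmt-QuantumFields-11686; unbundled by `nPointIsotropy_iff` into
`W1 → EightFrameRP → RadialKernel → PlanarInvariant`) implies this crux: the soft kernel triple of (B′) is made radial by
`radialKernel_of_softKernel` (`kernelTransfer_proof` + `ShellRigidity_proof`, fed with E3 and the proper signed permutations from `W₁`
and the eight frames), and the cone is discarded. [folklore] -/
theorem softKernelBoostCovariance_of_nPointIsotropy :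
    Summit.QuantumFields.YangMills.Theses.PencilRigidity.NPointIsotropy →
      Summit.QuantumFields.YangMills.Theses.MirrorModularBoosts.SoftKernelBoostCovariance := by
  intro hN
  rw [softKernelBoostCovariance_iff]
  rw [nPointIsotropy_iff] at hN
  intro G _ _ _ _ hG r sch S₁ hW h8 _ hK
  exact hN G hG r sch S₁ hW h8 (radialKernel_of_softKernel hW.2.1.2.2.2.2.1 hW.2.2.2.1 h8 hK)

/-- **(N) → (N′)**: `PencilRigidity.NPointIsotropy` (stmt-QuantumFields-11686) implies the threshold-side restatement
`CertificationLength.NPointIsotropyBelowThreshold` (stmt-QuantumFields-16180) — the planner's fifteen-line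
`npointIsotropyBelowThreshold_of_shared`: the soft kernel is radial by `radialKernel_of_softKernel`.  In particular any
refutation of (N′) refutes 11686. [folklore] -/
theorem belowThreshold_of_nPointIsotropy :
    Summit.QuantumFields.YangMills.Theses.PencilRigidity.NPointIsotropy →
      Summit.QuantumFields.YangMills.Theses.CertificationLength.NPointIsotropyBelowThreshold :=
  fun hN => stub_belowThresholdOfSoftKernel (softKernelBoostCovariance_of_nPointIsotropy hN)

/-- **(B) → (N′)**: the parent engine (stmt-QuantumFields-9663) implies the sibling route's crux (stmt-QuantumFields-16180).
[folklore] -/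
theorem belowThreshold_of_curvatureBoostCovariance :
    Summit.QuantumFields.YangMills.Theses.MirrorModularBoosts.CurvatureBoostCovariance →
      Summit.QuantumFields.YangMills.Theses.CertificationLength.NPointIsotropyBelowThreshold :=
  fun h => stub_belowThresholdOfSoftKernel (softKernelBoostCovariance_of_curvatureBoostCovariance h)

/-! ## §3 The web: modulo `CurvatureKernelBound` the four cruxes are one problem -/

/-- **The crux web.**  Unconditionally: (B) → (N) (the landed `nPointIsotropy_of_curvatureBoostCovariance`), (N) → (B′)
(`softKernelBoostCovariance_of_nPointIsotropy`), (B′) ↔ (N′) (`softKernelBoostCovariance_iff_belowThreshold`).  MODULO the UV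
datum `MirrorModularBoosts.CurvatureKernelBound` (stmt-QuantumFields-11687, shared verbatim with route PencilRigidity) the loop
closes by the landed glue `kernelBoundEngineGlue_proof` (stmt-QuantumFields-15000: `CurvatureKernelBound → (B′) → (B)`), so the
four cruxes 9663 / 11686 / 14999 / 16180 are pairwise EQUIVALENT: one Yang–Mills problem (planar boost covariance of the
curvature channel below the pencil threshold) filed four times on three routes. [folklore] -/
theorem cruxWeb_of_kernelBound
    (hKB : Summit.QuantumFields.YangMills.Theses.MirrorModularBoosts.CurvatureKernelBound) :
    (Summit.QuantumFields.YangMills.Theses.MirrorModularBoosts.CurvatureBoostCovariance ↔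
        Summit.QuantumFields.YangMills.Theses.MirrorModularBoosts.SoftKernelBoostCovariance) ∧
      (Summit.QuantumFields.YangMills.Theses.PencilRigidity.NPointIsotropy ↔
        Summit.QuantumFields.YangMills.Theses.MirrorModularBoosts.SoftKernelBoostCovariance) ∧
      (Summit.QuantumFields.YangMills.Theses.CertificationLength.NPointIsotropyBelowThreshold ↔
        Summit.QuantumFields.YangMills.Theses.MirrorModularBoosts.SoftKernelBoostCovariance) :=
  ⟨⟨softKernelBoostCovariance_of_curvatureBoostCovariance,
      fun hSoft => Summit.QuantumFields.YangMills.Theorems.kernelBoundEngineGlue_proof hKB hSoft⟩,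
    ⟨softKernelBoostCovariance_of_nPointIsotropy,
      fun hSoft =>
        Summit.QuantumFields.YangMills.Theorems.NPointIsotropy.ComplexRotationBandlimit.nPointIsotropy_of_kernelBound_of_softKernel
          hKB hSoft⟩,
    softKernelBoostCovariance_iff_belowThreshold.symm⟩

end Summit.QuantumFields.YangMills.Theorems.SoftKernelBoostCovariance.Sketch

end
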